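import Summits.AtomisticToContinuum.Crystallization.Theorems.ExcessDecayLiouvilleHcpLiouvilleBlowdownSobolevGen

/-!
# `ExcessDecayLiouville.HcpLiouville` (stmt-AtomisticToContinuum-9332), line `Sketch` (skeleton v4): the Sobolev step for the cross difference

Helper for stub `stub_interior` (step (5) of the interior estimate for `L`-harmonic fields, the ADDENDUM on the cross
bond): the lattice Sobolev inequality D3 applied to the cross-difference field
`G×(x) = 𝟙[x ∈ S₀]·(F(x + τ) − F x)`, `τ = t 1 − t 0`, `S₀ = t 0 + AΛ₀` the sublattice `0`.  At a site of sublattice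
`0` all the lattice shifts stay in sublattice `0`, so the mixed differences of `G×` appearing in D3 are cross-bond
differences `H(p + τ) − H(p)` of the iterated difference fields `H = D_{e_k}⋯D_{e_1}F`; at the sites of sublattice `1`
they vanish.  Hence every sum of D3 is dominated by a nearest-neighbour energy (`Blowdown.tsum_ball_crossDiff_sq_le`)
and (`blowdown_sobolevCross`, registered) `‖F(p₀ + τ) − F p₀‖² ≤ C_S(ℓ⁻³B₀ + 3ℓ⁻¹B₁ + 9ℓB₂ + 27ℓ³B₃)` for the sites
`p₀ ∈ S₀ ∩ B_ℓ(c)`.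
All `[folklore]`; a `--supports` helper for item stmt-AtomisticToContinuum-9332, nothing here closes an item.
-/

noncomputable section

namespace Summit.AtomisticToContinuum.Crystallization.Theorems.ExcessDecayLiouville

open scoped BigOperators Topology Classical InnerProductSpace RealInnerProductSpace
open Literature.MathematicalPhysics.StatisticalMechanics
open Summit.AtomisticToContinuum.Crystallization.Theses.ExcessDecayLiouville
open Summit.AtomisticToContinuum.Crystallization.Theorems.PhononStabilityNegative

namespace Blowdown

open LevelOne

variable {t : Fin 2 → (EuclideanSpace ℝ (Fin 3))}
  {A : (EuclideanSpace ℝ (Fin 3)) →L[ℝ] (EuclideanSpace ℝ (Fin 3))}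

/-! ## Sublattice `0` is invariant under the lattice shifts -/

/-- `x ∈ S₀ ⇒ x + A v ∈ S₀` for `v ∈ Λ₀`. [folklore] -/
theorem mem0_add {x v : EuclideanSpace ℝ (Fin 3)} (hx : ∃ w ∈ Λ₀, x = t 0 + A w) (hv : v ∈ Λ₀) :
    ∃ w ∈ Λ₀, x + A v = t 0 + A w := by
  obtain ⟨w, hw, rfl⟩ := hx
  exact ⟨w + v, hcpLiouvilleLam_add_mem hw hv, by rw [map_add]; abel⟩

/-- `x + A v ∈ S₀ ⇒ x ∈ S₀` for `v ∈ Λ₀`. [folklore] -/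
theorem mem0_of_add {x v : EuclideanSpace ℝ (Fin 3)} (h : ∃ w ∈ Λ₀, x + A v = t 0 + A w) (hv : v ∈ Λ₀) :
    ∃ w ∈ Λ₀, x = t 0 + A w := by
  obtain ⟨w, hw, hxw⟩ := h
  exact ⟨w - v, hcpLiouvilleLam_sub_mem hw hv, by rw [map_sub, ← add_sub_assoc, ← hxw, add_sub_cancel_right]⟩

/-! ## The four sums of D3 for the cross-difference field -/

/-- **The sums of D3 for the cross-difference field** `G×(x) = 𝟙[x ∈ S₀](F(x + τ) − F x)` are dominated by the
nearest-neighbour energies of `F` and of its iterated generator differences: `≤ B₀, 3B₁, 9B₂, 27B₃`. [folklore] -/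
theorem sobolev_sums_cross (hA : Adm₀ A) (hI : Inner₀ t A) (F : EuclideanSpace ℝ (Fin 3) → EuclideanSpace ℝ (Fin 3))
    (c : EuclideanSpace ℝ (Fin 3)) {ℓ B₀ B₁ B₂ B₃ : ℝ} (gens : Finset (EuclideanSpace ℝ (Fin 3)))
    (hgens : gens = {triangularVec₁ 1, triangularVec₂ 1, layerNormal (2 * Real.sqrt (2 / 3))}) (hne : gens.Nonempty)
    (hB0 : nnEnergy (Sites₀ t A) F c (5 * ℓ + 2) ≤ B₀)
    (hB1 : ∀ e₁ ∈ gens, nnEnergy (Sites₀ t A) (fun x => F (x + A e₁) - F x) c (5 * ℓ + 2) ≤ B₁)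
    (hB2 : ∀ e₁ ∈ gens, ∀ e₂ ∈ gens,
      nnEnergy (Sites₀ t A) (fun x => (F (x + A e₂ + A e₁) - F (x + A e₂)) - (F (x + A e₁) - F x)) c (5 * ℓ + 2) ≤ B₂)
    (hB3 : ∀ e₁ ∈ gens, ∀ e₂ ∈ gens, ∀ e₃ ∈ gens,
      nnEnergy (Sites₀ t A) (fun x => ((F (x + A e₃ + A e₂ + A e₁) - F (x + A e₃ + A e₂)) -
        (F (x + A e₃ + A e₁) - F (x + A e₃))) - ((F (x + A e₂ + A e₁) - F (x + A e₂)) - (F (x + A e₁) - F x)))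
        c (5 * ℓ + 2) ≤ B₃)
    (G : EuclideanSpace ℝ (Fin 3) → EuclideanSpace ℝ (Fin 3))
    (hG : ∀ x, G x = if ∃ w ∈ Λ₀, x = t 0 + A w then F (x + (t 1 - t 0)) - F x else 0) :
    (∑' p : {s : EuclideanSpace ℝ (Fin 3) // s ∈ Sites₀ t A ∧ dist s c ≤ 5 * ℓ}, ‖G p‖ ^ 2 ≤ B₀) ∧
    (∑' p : {s : EuclideanSpace ℝ (Fin 3) // s ∈ Sites₀ t A ∧ dist s c ≤ 5 * ℓ}, ∑ e ∈ gens,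
        ‖G (p + A e) - G p‖ ^ 2 ≤ 3 * B₁) ∧
    (∑' p : {s : EuclideanSpace ℝ (Fin 3) // s ∈ Sites₀ t A ∧ dist s c ≤ 5 * ℓ}, ∑ e ∈ gens, ∑ e' ∈ gens,
        ‖G (p + A e + A e') - G (p + A e) - G (p + A e') + G p‖ ^ 2 ≤ 3 * (3 * B₂)) ∧
    (∑' p : {s : EuclideanSpace ℝ (Fin 3) // s ∈ Sites₀ t A ∧ dist s c ≤ 5 * ℓ}, ∑ e ∈ gens, ∑ e' ∈ gens, ∑ e'' ∈ gens,
        ‖G (p + A e + A e' + A e'') - G (p + A e + A e') - G (p + A e + A e'') - G (p + A e' + A e'') +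
          G (p + A e) + G (p + A e') + G (p + A e'') - G p‖ ^ 2 ≤ 3 * (3 * (3 * B₃))) := by
  have hgen : ∀ {e : EuclideanSpace ℝ (Fin 3)}, e ∈ gens → e ∈ Λ₀ ∧ ‖A e‖ ≤ 2 := fun he =>
    gen_mem_and_norm_le hA (by rwa [hgens] at he)
  have hcard : gens.card ≤ 3 := by rw [hgens]; exact Finset.card_le_three
  obtain ⟨e₀, he₀⟩ := hne
  have hE0 : ∀ (H : EuclideanSpace ℝ (Fin 3) → EuclideanSpace ℝ (Fin 3)) (r : ℝ), 0 ≤ nnEnergy (Sites₀ t A) H c r :=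
    fun H r => nnEnergy_nonneg _ _ _ _
  have hB1' : 0 ≤ B₁ := (hE0 _ _).trans (hB1 e₀ he₀)
  have hB2' : 0 ≤ B₂ := (hE0 _ _).trans (hB2 e₀ he₀ e₀ he₀)
  have hB3' : 0 ≤ B₃ := (hE0 _ _).trans (hB3 e₀ he₀ e₀ he₀ e₀ he₀)
  have hmono : ∀ (H : EuclideanSpace ℝ (Fin 3) → EuclideanSpace ℝ (Fin 3)),
      nnEnergy (Sites₀ t A) H c (5 * ℓ) ≤ nnEnergy (Sites₀ t A) H c (5 * ℓ + 2) :=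
    fun H => nnEnergy_le_of_le hA hI H c (by linarith)
  -- `τ = t 1 - t 0` is the cross step
  refine ⟨?_, ?_, ?_, ?_⟩
  · -- zeroth sum
    have h := tsum_ball_crossDiff_sq_le hA hI F c (5 * ℓ)
    refine (le_of_eq (tsum_congr fun p => by rw [hG])).trans (h.trans ((hmono F).trans hB0))
  · refine tsum_ball_finset_sum_le hA hI c (5 * ℓ) gens hcard (fun e x => ‖G (x + A e) - G x‖ ^ 2) (B := B₁) hB1' fun e he => ?_
    obtain ⟨hem, -⟩ := hgen he
    have h := tsum_ball_crossDiff_sq_le hA hI (fun x => F (x + A e) - F x) c (5 * ℓ)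
    refine (le_of_eq (tsum_congr fun p => ?_)).trans (h.trans ((hmono _).trans (hB1 e he)))
    rw [hG, hG]
    by_cases hp : ∃ w ∈ Λ₀, (p : EuclideanSpace ℝ (Fin 3)) = t 0 + A w
    · rw [if_pos (mem0_add hp hem), if_pos hp, if_pos hp]
      have e1 : (p : EuclideanSpace ℝ (Fin 3)) + A e + (t 1 - t 0) = (p : EuclideanSpace ℝ (Fin 3)) + (t 1 - t 0) + A e := by
        abel
      rw [e1]
      congr 2
      abel
    · rw [if_neg (fun h => hp (mem0_of_add h hem)), if_neg hp, if_neg hp, sub_zero]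
  · refine tsum_ball_finset_sum_le hA hI c (5 * ℓ) gens hcard
      (fun e x => ∑ e' ∈ gens, ‖G (x + A e + A e') - G (x + A e) - G (x + A e') + G x‖ ^ 2) (B := 3 * B₂) (by positivity) fun e he => ?_
    refine tsum_ball_finset_sum_le hA hI c (5 * ℓ) gens hcard (fun e' x => ‖G (x + A e + A e') - G (x + A e) - G (x + A e') + G x‖ ^ 2) (B := B₂) hB2' fun e' he' => ?_
    obtain ⟨hem, -⟩ := hgen he
    obtain ⟨hem', -⟩ := hgen he'
    have h := tsum_ball_crossDiff_sq_le hA hI (fun x => (F (x + A e' + A e) - F (x + A e')) - (F (x + A e) - F x))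
      c (5 * ℓ)
    refine (le_of_eq (tsum_congr fun p => ?_)).trans (h.trans ((hmono _).trans (hB2 e he e' he')))
    rw [hG, hG, hG, hG]
    by_cases hp : ∃ w ∈ Λ₀, (p : EuclideanSpace ℝ (Fin 3)) = t 0 + A w
    · rw [if_pos (mem0_add (mem0_add hp hem) hem'), if_pos (mem0_add hp hem), if_pos (mem0_add hp hem'),
        if_pos hp, if_pos hp]
      have e1 : (p : EuclideanSpace ℝ (Fin 3)) + A e + A e' + (t 1 - t 0) = (p : EuclideanSpace ℝ (Fin 3)) + (t 1 - t 0) + A e' + A e := by abel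
      have e2 : (p : EuclideanSpace ℝ (Fin 3)) + A e + A e' = (p : EuclideanSpace ℝ (Fin 3)) + A e' + A e := by abel
      have e3 : (p : EuclideanSpace ℝ (Fin 3)) + A e + (t 1 - t 0) = (p : EuclideanSpace ℝ (Fin 3)) + (t 1 - t 0) + A e := by abel
      have e4 : (p : EuclideanSpace ℝ (Fin 3)) + A e' + (t 1 - t 0) = (p : EuclideanSpace ℝ (Fin 3)) + (t 1 - t 0) + A e' := by abel
      rw [e1, e2, e3, e4]
      congr 2
      abel
    · rw [if_neg (fun h => hp (mem0_of_add (mem0_of_add h hem') hem)), if_neg (fun h => hp (mem0_of_add h hem)),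
        if_neg (fun h => hp (mem0_of_add h hem')), if_neg hp, if_neg hp]
      simp
  · refine tsum_ball_finset_sum_le hA hI c (5 * ℓ) gens hcard
      (fun e x => ∑ e' ∈ gens, ∑ e'' ∈ gens, ‖G (x + A e + A e' + A e'') - G (x + A e + A e') - G (x + A e + A e'') - G (x + A e' + A e'') + G (x + A e) + G (x + A e') + G (x + A e'') - G x‖ ^ 2) (B := 3 * (3 * B₃)) (by positivity) fun e he => ?_
    refine tsum_ball_finset_sum_le hA hI c (5 * ℓ) gens hcard
      (fun e' x => ∑ e'' ∈ gens, ‖G (x + A e + A e' + A e'') - G (x + A e + A e') - G (x + A e + A e'') - G (x + A e' + A e'') + G (x + A e) + G (x + A e') + G (x + A e'') - G x‖ ^ 2) (B := 3 * B₃) (by positivity) fun e' he' => ?_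
    refine tsum_ball_finset_sum_le hA hI c (5 * ℓ) gens hcard
      (fun e'' x => ‖G (x + A e + A e' + A e'') - G (x + A e + A e') - G (x + A e + A e'') - G (x + A e' + A e'') + G (x + A e) + G (x + A e') + G (x + A e'') - G x‖ ^ 2) (B := B₃) hB3' fun e'' he'' => ?_
    obtain ⟨hem, -⟩ := hgen he
    obtain ⟨hem', -⟩ := hgen he'
    obtain ⟨hem'', -⟩ := hgen he''
    have h := tsum_ball_crossDiff_sq_le hA hI (fun x => ((F (x + A e'' + A e' + A e) - F (x + A e'' + A e')) -
        (F (x + A e'' + A e) - F (x + A e''))) - ((F (x + A e' + A e) - F (x + A e')) - (F (x + A e) - F x))) c (5 * ℓ)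
    refine (le_of_eq (tsum_congr fun p => ?_)).trans (h.trans ((hmono _).trans (hB3 e he e' he' e'' he'')))
    rw [hG, hG, hG, hG, hG, hG, hG, hG]
    by_cases hp : ∃ w ∈ Λ₀, (p : EuclideanSpace ℝ (Fin 3)) = t 0 + A w
    · rw [if_pos (mem0_add (mem0_add (mem0_add hp hem) hem') hem''), if_pos (mem0_add (mem0_add hp hem) hem'),
        if_pos (mem0_add (mem0_add hp hem) hem''), if_pos (mem0_add (mem0_add hp hem') hem''),
        if_pos (mem0_add hp hem), if_pos (mem0_add hp hem'), if_pos (mem0_add hp hem''), if_pos hp, if_pos hp]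
      have e1 : (p : EuclideanSpace ℝ (Fin 3)) + A e + A e' + A e'' + (t 1 - t 0) =
          (p : EuclideanSpace ℝ (Fin 3)) + (t 1 - t 0) + A e'' + A e' + A e := by abel
      have e2 : (p : EuclideanSpace ℝ (Fin 3)) + A e + A e' + A e'' =
          (p : EuclideanSpace ℝ (Fin 3)) + A e'' + A e' + A e := by abel
      have e3 : (p : EuclideanSpace ℝ (Fin 3)) + A e + A e' + (t 1 - t 0) = (p : EuclideanSpace ℝ (Fin 3)) + (t 1 - t 0) + A e' + A e := by abel
      have e4 : (p : EuclideanSpace ℝ (Fin 3)) + A e + A e' = (p : EuclideanSpace ℝ (Fin 3)) + A e' + A e := by abel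
      have e5 : (p : EuclideanSpace ℝ (Fin 3)) + A e + A e'' + (t 1 - t 0) = (p : EuclideanSpace ℝ (Fin 3)) + (t 1 - t 0) + A e'' + A e := by abel
      have e6 : (p : EuclideanSpace ℝ (Fin 3)) + A e + A e'' = (p : EuclideanSpace ℝ (Fin 3)) + A e'' + A e := by abel
      have e7 : (p : EuclideanSpace ℝ (Fin 3)) + A e' + A e'' + (t 1 - t 0) = (p : EuclideanSpace ℝ (Fin 3)) + (t 1 - t 0) + A e'' + A e' := by abel
      have e8 : (p : EuclideanSpace ℝ (Fin 3)) + A e' + A e'' = (p : EuclideanSpace ℝ (Fin 3)) + A e'' + A e' := by abel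
      have e9 : (p : EuclideanSpace ℝ (Fin 3)) + A e + (t 1 - t 0) = (p : EuclideanSpace ℝ (Fin 3)) + (t 1 - t 0) + A e := by abel
      have e10 : (p : EuclideanSpace ℝ (Fin 3)) + A e' + (t 1 - t 0) = (p : EuclideanSpace ℝ (Fin 3)) + (t 1 - t 0) + A e' := by abel
      have e11 : (p : EuclideanSpace ℝ (Fin 3)) + A e'' + (t 1 - t 0) = (p : EuclideanSpace ℝ (Fin 3)) + (t 1 - t 0) + A e'' := by abel
      rw [e1, e2, e3, e4, e5, e6, e7, e8, e9, e10, e11]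
      congr 2
      abel
    · rw [if_neg (fun h => hp (mem0_of_add (mem0_of_add (mem0_of_add h hem'') hem') hem)),
        if_neg (fun h => hp (mem0_of_add (mem0_of_add h hem') hem)),
        if_neg (fun h => hp (mem0_of_add (mem0_of_add h hem'') hem)),
        if_neg (fun h => hp (mem0_of_add (mem0_of_add h hem'') hem')),
        if_neg (fun h => hp (mem0_of_add h hem)), if_neg (fun h => hp (mem0_of_add h hem')),
        if_neg (fun h => hp (mem0_of_add h hem'')), if_neg hp, if_neg hp]
      simp

end Blowdown

open LevelOne in
/-- **The Sobolev step for the cross difference** (registered sub-goal `blowdown_sobolevCross`, ADDENDUM of step (5)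
of stub `stub_interior`, crux stmt-AtomisticToContinuum-9332, line `Sketch` v4): if the nearest-neighbour energies on
`B_{5ℓ+2}(c)` of `F` and of its `k`-fold generator differences (`k ≤ 3`) are bounded by `B₀, B₁, B₂, B₃`, then at
every site `p₀` of sublattice `0` in `B_ℓ(c)` (`ℓ ≥ 8`) the cross difference obeys
`‖F(p₀ + (t 1 − t 0)) − F p₀‖² ≤ C(ℓ⁻³B₀ + ℓ⁻¹B₁ + ℓB₂ + ℓ³B₃)`. [folklore] -/
theorem blowdown_sobolevCross : ∃ C : ℝ, 0 ≤ C ∧ ∀ (t : Fin 2 → (EuclideanSpace ℝ (Fin 3)))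
    (A : (EuclideanSpace ℝ (Fin 3)) →L[ℝ] (EuclideanSpace ℝ (Fin 3))), Adm₀ A → Inner₀ t A →
    ∀ (F : (EuclideanSpace ℝ (Fin 3)) → (EuclideanSpace ℝ (Fin 3))) (c : (EuclideanSpace ℝ (Fin 3)))
      (ℓ B₀ B₁ B₂ B₃ : ℝ), 8 ≤ ℓ →
      Blowdown.nnEnergy (Sites₀ t A) F c (5 * ℓ + 2) ≤ B₀ →
      (∀ e₁ ∈ ({triangularVec₁ 1, triangularVec₂ 1, layerNormal (2 * Real.sqrt (2 / 3))} :
          Finset (EuclideanSpace ℝ (Fin 3))),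
        Blowdown.nnEnergy (Sites₀ t A) (fun x => F (x + A e₁) - F x) c (5 * ℓ + 2) ≤ B₁) →
      (∀ e₁ ∈ ({triangularVec₁ 1, triangularVec₂ 1, layerNormal (2 * Real.sqrt (2 / 3))} :
          Finset (EuclideanSpace ℝ (Fin 3))),
        ∀ e₂ ∈ ({triangularVec₁ 1, triangularVec₂ 1, layerNormal (2 * Real.sqrt (2 / 3))} :
          Finset (EuclideanSpace ℝ (Fin 3))),
        Blowdown.nnEnergy (Sites₀ t A) (fun x => (F (x + A e₂ + A e₁) - F (x + A e₂)) - (F (x + A e₁) - F x))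
          c (5 * ℓ + 2) ≤ B₂) →
      (∀ e₁ ∈ ({triangularVec₁ 1, triangularVec₂ 1, layerNormal (2 * Real.sqrt (2 / 3))} :
          Finset (EuclideanSpace ℝ (Fin 3))),
        ∀ e₂ ∈ ({triangularVec₁ 1, triangularVec₂ 1, layerNormal (2 * Real.sqrt (2 / 3))} :
          Finset (EuclideanSpace ℝ (Fin 3))),
        ∀ e₃ ∈ ({triangularVec₁ 1, triangularVec₂ 1, layerNormal (2 * Real.sqrt (2 / 3))} :
          Finset (EuclideanSpace ℝ (Fin 3))),
        Blowdown.nnEnergy (Sites₀ t A) (fun x => ((F (x + A e₃ + A e₂ + A e₁) - F (x + A e₃ + A e₂)) -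
          (F (x + A e₃ + A e₁) - F (x + A e₃))) - ((F (x + A e₂ + A e₁) - F (x + A e₂)) - (F (x + A e₁) - F x)))
          c (5 * ℓ + 2) ≤ B₃) →
      ∀ p₀ ∈ Sites₀ t A, (∃ w ∈ Λ₀, p₀ = t 0 + A w) → dist p₀ c ≤ ℓ →
        ‖F (p₀ + (t 1 - t 0)) - F p₀‖ ^ 2 ≤ C * ((ℓ⁻¹) ^ 3 * B₀ + ℓ⁻¹ * B₁ + ℓ * B₂ + ℓ ^ 3 * B₃) := by
  obtain ⟨C_S, hS⟩ := blowdown_latticeSobolev3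
  refine ⟨max C_S 0 * 27, by positivity, ?_⟩
  intro t A hA hI F c ℓ B₀ B₁ B₂ B₃ hℓ hB0 hB1 hB2 hB3 p₀ hp₀ hp₀0 hp₀c
  obtain ⟨gens, hgens⟩ : ∃ gens : Finset (EuclideanSpace ℝ (Fin 3)),
      gens = {triangularVec₁ 1, triangularVec₂ 1, layerNormal (2 * Real.sqrt (2 / 3))} := ⟨_, rfl⟩
  rw [← hgens] at hB1 hB2 hB3
  have hne : gens.Nonempty := ⟨triangularVec₁ 1, by rw [hgens]; simp⟩
  obtain ⟨G, hG⟩ : ∃ G : EuclideanSpace ℝ (Fin 3) → EuclideanSpace ℝ (Fin 3),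
      ∀ x, G x = if ∃ w ∈ Λ₀, x = t 0 + A w then F (x + (t 1 - t 0)) - F x else 0 := ⟨_, fun _ => rfl⟩
  obtain ⟨h0, h1, h2, h3⟩ := Blowdown.sobolev_sums_cross hA hI F c gens hgens hne hB0 hB1 hB2 hB3 G hG
  have hmain := hS t A hA hI G c ℓ hℓ p₀ hp₀ hp₀c
  rw [← hgens, hG p₀, if_pos hp₀0] at hmain
  have hℓ0 : 0 < ℓ := by linarith
  have hB0' : 0 ≤ B₀ := (Blowdown.nnEnergy_nonneg _ _ _ _).trans hB0
  have he₀ : triangularVec₁ 1 ∈ gens := by rw [hgens]; simp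
  have hB1' : 0 ≤ B₁ := (Blowdown.nnEnergy_nonneg _ _ _ _).trans (hB1 _ he₀)
  have hB2' : 0 ≤ B₂ := (Blowdown.nnEnergy_nonneg _ _ _ _).trans (hB2 _ he₀ _ he₀)
  have hB3' : 0 ≤ B₃ := (Blowdown.nnEnergy_nonneg _ _ _ _).trans (hB3 _ he₀ _ he₀ _ he₀)
  have hX0 : 0 ≤ (ℓ⁻¹) ^ 3 * ∑' p : {s : EuclideanSpace ℝ (Fin 3) // s ∈ Sites₀ t A ∧ dist s c ≤ 5 * ℓ}, ‖G p‖ ^ 2 +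
      ℓ⁻¹ * ∑' p : {s : EuclideanSpace ℝ (Fin 3) // s ∈ Sites₀ t A ∧ dist s c ≤ 5 * ℓ}, ∑ e ∈ gens,
        ‖G (p + A e) - G p‖ ^ 2 +
      ℓ * ∑' p : {s : EuclideanSpace ℝ (Fin 3) // s ∈ Sites₀ t A ∧ dist s c ≤ 5 * ℓ}, ∑ e ∈ gens, ∑ e' ∈ gens,
        ‖G (p + A e + A e') - G (p + A e) - G (p + A e') + G p‖ ^ 2 +
      ℓ ^ 3 * ∑' p : {s : EuclideanSpace ℝ (Fin 3) // s ∈ Sites₀ t A ∧ dist s c ≤ 5 * ℓ}, ∑ e ∈ gens, ∑ e' ∈ gens,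
        ∑ e'' ∈ gens, ‖G (p + A e + A e' + A e'') - G (p + A e + A e') - G (p + A e + A e'') - G (p + A e' + A e'') +
          G (p + A e) + G (p + A e') + G (p + A e'') - G p‖ ^ 2 := by
    have hi3 : 0 ≤ (ℓ⁻¹) ^ 3 := by positivity
    have hi1 : 0 ≤ ℓ⁻¹ := by positivity
    have hl3 : 0 ≤ ℓ ^ 3 := by positivity
    refine add_nonneg (add_nonneg (add_nonneg (mul_nonneg hi3 (tsum_nonneg fun _ => sq_nonneg _))
      (mul_nonneg hi1 (tsum_nonneg fun _ => Finset.sum_nonneg fun _ _ => sq_nonneg _)))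
      (mul_nonneg hℓ0.le (tsum_nonneg fun _ => Finset.sum_nonneg fun _ _ => Finset.sum_nonneg fun _ _ => sq_nonneg _)))
      (mul_nonneg hl3 (tsum_nonneg fun _ => Finset.sum_nonneg fun _ _ => Finset.sum_nonneg fun _ _ =>
        Finset.sum_nonneg fun _ _ => sq_nonneg _))
  calc ‖F (p₀ + (t 1 - t 0)) - F p₀‖ ^ 2 ≤ _ := hmain
    _ ≤ max C_S 0 * ((ℓ⁻¹) ^ 3 * B₀ + ℓ⁻¹ * (3 * B₁) + ℓ * (3 * (3 * B₂)) + ℓ ^ 3 * (3 * (3 * (3 * B₃)))) := by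
        refine (mul_le_mul_of_nonneg_right (le_max_left _ _) hX0).trans (mul_le_mul_of_nonneg_left ?_ (le_max_right _ _))
        have hi3 : 0 ≤ (ℓ⁻¹) ^ 3 := by positivity
        have hi1 : 0 ≤ ℓ⁻¹ := by positivity
        have hl3 : 0 ≤ ℓ ^ 3 := by positivity
        exact add_le_add (add_le_add (add_le_add (mul_le_mul_of_nonneg_left h0 hi3) (mul_le_mul_of_nonneg_left h1 hi1))
          (mul_le_mul_of_nonneg_left h2 hℓ0.le)) (mul_le_mul_of_nonneg_left h3 hl3)
    _ ≤ max C_S 0 * 27 * ((ℓ⁻¹) ^ 3 * B₀ + ℓ⁻¹ * B₁ + ℓ * B₂ + ℓ ^ 3 * B₃) := by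
        have hm : 0 ≤ max C_S 0 := le_max_right _ _
        have h4 : 0 ≤ (ℓ⁻¹) ^ 3 * B₀ := by positivity
        have h5 : 0 ≤ ℓ⁻¹ * B₁ := by positivity
        have h6 : 0 ≤ ℓ * B₂ := by positivity
        nlinarith

end Summit.AtomisticToContinuum.Crystallization.Theorems.ExcessDecayLiouville

end
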